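import Literature.AnabelianGeometry.EtaleTheta.SettingModelChiZNStandardSplitting
import Literature.AnabelianGeometry.EtaleTheta.SettingModelTateZClass
import Literature.AnabelianGeometry.EtaleTheta.SettingModelTateDoubleUnderline
import HarnessLib

/-!
# The STAGE-2 model: `N·(Δ^tp_Y)^Θ` in level coordinates and the `Z_N`-clause for the standard splitting
# (stage-2 twin of `SettingModelChiZNStandardSplitting`; proof-only)

Mochizuki, *The étale theta function …*, Publ. RIMS **45** (2009) [EtTh], §1 pp. 13–14 [cite: MochizukiEtTh2009, §1 p.14].
abc-iut cell, layer L2, prover abc-iut-L2-d1 (gen 5); PROOF-ONLY stage-2 twin of this seat's `SettingModelChiZNStandardSplitting`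
(NV sizing of abc-iut-L2-t1's origin clause `GtpZNFromSplitting`, p446335) at abc-iut-L2-t5's `ThetaSetting.modelχq p i j hj`
(`Π^tp_X = Γ ⋊_{actχq} G_{ℚ_p}`, `Y_N = dY N ⋊ G_{K_N}`, `Z_N = dZ N ⋊ G_{J_N}`): the Tate shear acts on the Galois factor only,
so the geometric computation is verbatim the stage-1 one —
* `toThetaq_inl_mem_thetaPowersY_iff` — for `γ ∈ Ker pr₂`: `θ(inl γ) ∈ N·(Δ^tp_Y)^Θ ↔ ĥ_N(γ) = 1`;
* `isThetaSplittingAt_inr_modelχq` — the standard splitting `σ ↦ θ(inr σ)` over `G_{K_N}` is a lifted splitting;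
* **`gtpZN_iff_of_inr_splitting_modelχq`** — the clause of `GtpZNFromSplitting` HOLDS for it; `exists_thetaSplitting_gtpZN_iff_modelχq`.
The ∀-splittings predicate is NOT claimed (no continuity in `IsThetaSplittingAt`; finding F-L2d1g5-1).
SEMI-SYNTHETIC MODEL, consistency evidence only; nothing of [EtTh] asserted; no side taken on [IUTchIII] Cor. 3.12.
-/

noncomputable section

namespace Literature.AnabelianGeometry.EtaleTheta.SettingModel

open Literature.AnabelianGeometry.SemiGraphs _root_.Function

variable (p : ℕ) [Fact p.Prime] (i j : ℤ) (hj : Even j) (N : ℕ+)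

/-- `inl δ ∈ Δ^tp_Y` of the stage-2 model for `δ ∈ Ker pr₂` (all `i`, even `j`). [cite: MochizukiEtTh2009, §1 p.12] -/
theorem inl_mem_dtpY_modelχq_of_mem_ker {δ : Gfp} (hδ : δ ∈ gfpSnd.ker) :
    (SemidirectProduct.inl δ : PiTpχq p i j) ∈ (ThetaSetting.modelχq p i j hj).DtpY := by
  refine Subgroup.mem_inf.mpr ⟨?_, inl_mem_deltaTempχq p i j δ⟩
  change (tateTwistData₀ p i j).toZ (SemidirectProduct.inl δ) = 1
  rw [GfpTwistData₀.toZ_apply, SemidirectProduct.left_inl]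
  exact hδ

/-- Equal images in `(Π^tp_X)^Θ` of `inl γ`, `inl γ′` force equal level shadows (stage 2). [cite: MochizukiEtTh2009, §1 p.12] -/
theorem levelHom_eq_of_toThetaq_inl_eq {γ γ' : Gfp}
    (h : CurveTheta.toTheta (curveχq p i j) (SemidirectProduct.inl γ) =
      CurveTheta.toTheta (curveχq p i j) (SemidirectProduct.inl γ')) (M : ℕ+) :
    levelHom M γ = levelHom M γ' := by
  rw [CurveTheta.toTheta, QuotientGroup.mk'_apply, QuotientGroup.mk'_apply, QuotientGroup.eq_iff_div_mem,
    ← map_div, mem_thetaKerχq_iff] at h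
  have h1 := h.1 M
  rw [SemidirectProduct.left_inl, map_div, map_div] at h1
  exact div_eq_one.mp h1

/-! ### `N·(Δ^tp_Y)^Θ` at the stage-2 model -/

/-- `N·(Δ^tp_Y)^Θ ≤ θ(inl(Δ^tp_{Z_N}))` (stage 2). [cite: MochizukiEtTh2009, §1 p.14] -/
theorem thetaPowersY_modelχq_le :
    (ThetaSetting.modelχq p i j hj).thetaPowersY N ≤
      (dZ N).map ((CurveTheta.toTheta (curveχq p i j)).comp (SemidirectProduct.inl : Gfp →* PiTpχq p i j)) := by
  rw [ThetaSetting.thetaPowersY, Subgroup.closure_le]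
  rintro _ ⟨y, hy, rfl⟩
  obtain ⟨g, hg, rfl⟩ := hy
  obtain ⟨hgY, hgΔ⟩ := Subgroup.mem_inf.mp hg
  have hr : g.right = 1 := (mem_deltaTempχq_iff p i j g).mp hgΔ
  have hs : g.left ∈ gfpSnd.ker := gfpSnd_left_eq_one_of_mem_gtpY_modelχq p i j hj hgY
  have hg' : g = SemidirectProduct.inl g.left := by
    rw [← SemidirectProduct.inl_left_mul_inr_right g, hr, map_one, mul_one]
    rfl
  refine ⟨g.left ^ (N : ℕ), pow_mem_dZ_of_mem_ker N hs, ?_⟩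
  change CurveTheta.toTheta (curveχq p i j) (SemidirectProduct.inl (g.left ^ (N : ℕ))) =
    CurveTheta.toTheta (curveχq p i j) g ^ (N : ℕ)
  rw [map_pow, map_pow, ← hg']

/-- `θ(inl(Δ^tp_{Z_N})) ≤ N·(Δ^tp_Y)^Θ` (stage 2): `θ(inl γ) = θ(inl(b^s c^u))^N` with `s^N = ŷ(γ)`, `u^N = ẑ(γ)`.
[cite: MochizukiEtTh2009, §1 p.14] -/
theorem toThetaq_inl_mem_thetaPowersY_of_mem_dZ {γ : Gfp} (hγ : γ ∈ dZ N) :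
    CurveTheta.toTheta (curveχq p i j) (SemidirectProduct.inl γ) ∈ (ThetaSetting.modelχq p i j hj).thetaPowersY N := by
  obtain ⟨hs, hl⟩ := Subgroup.mem_inf.mp hγ
  rw [MonoidHom.mem_ker] at hl
  obtain ⟨t, ht⟩ := exists_zHat_forall_hHat_z_eq (gfpFst γ)
  have hy : ZHatLevel.level N (eHatB (gfpFst γ)) = 1 := by
    rw [← modN_eq_level, ← hHat_y_eq_zero_iff]
    change (levelHom N γ).y = 0
    rw [hl]
    rfl
  have htN : ZHatLevel.level N t = 1 := by
    have h := ht N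
    change _ = (levelHom N γ).z at h
    rw [hl] at h
    rw [← modN_eq_level, ← ofAdd_toAdd (modN N t), h]
    rfl
  obtain ⟨s, hs'⟩ := (ZHatLevel.level_eq_one_iff_exists_pow N _).mp hy
  obtain ⟨u, hu⟩ := (ZHatLevel.level_eq_one_iff_exists_pow N _).mp htN
  have hδ : bPowGfp s * cGfpχ u ∈ gfpSnd.ker := by
    rw [MonoidHom.mem_ker, map_mul, gfpSnd_bPowGfp, one_mul]
    rfl
  have hδY : (SemidirectProduct.inl (bPowGfp s * cGfpχ u) : PiTpχq p i j) ∈ (ThetaSetting.modelχq p i j hj).DtpY :=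
    inl_mem_dtpY_modelχq_of_mem_ker p i j hj hδ
  have key : CurveTheta.toTheta (curveχq p i j) (SemidirectProduct.inl γ) =
      CurveTheta.toTheta (curveχq p i j) (SemidirectProduct.inl ((bPowGfp s * cGfpχ u) ^ (N : ℕ))) := by
    refine toThetaq_eq_of_right_eq_one p i j _ _ (SemidirectProduct.right_inl _) (SemidirectProduct.right_inl _) ?_
    rw [mem_closure_commutator₃_iff_forall_hHat]
    intro M
    rw [SemidirectProduct.left_inl, SemidirectProduct.left_inl, map_mul, map_inv]
    change levelHom M γ * (levelHom M ((bPowGfp s * cGfpχ u) ^ (N : ℕ)))⁻¹ = 1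
    rw [mul_inv_eq_one, map_pow, map_mul, levelHom_bPowGfp]
    change hHat M (gfpFst γ) = (_ * hHat M (gfpFst (cGfpχ u))) ^ (N : ℕ)
    have hx0 : ((⟨0, Multiplicative.toAdd (ZHatLevel.level M s), 0⟩ : Heis (ZMod M)) *
        hHat M (gfpFst (cGfpχ u))).x = 0 := by
      rw [gfpFst_cGfpχ, hHat_powHat_commutator, Heis.mul_x, add_zero]
    rw [Heis.pow_eq_of_x_eq_zero _ hx0, gfpFst_cGfpχ, hHat_powHat_commutator]
    have hyM : (hHat M (gfpFst γ)).y = (N : ZMod M) * Multiplicative.toAdd (ZHatLevel.level M s) := by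
      have h := hHat_y_eq_modN_eHatB M (gfpFst γ)
      rw [← hs', modN_eq_level, map_pow] at h
      rw [← toAdd_ofAdd (hHat M (gfpFst γ)).y, h, toAdd_pow, nsmul_eq_mul]
    have hzM : (hHat M (gfpFst γ)).z = (N : ZMod M) * Multiplicative.toAdd (ZHatLevel.level M u) := by
      rw [← ht M, ← hu, modN_eq_level, map_pow, toAdd_pow, nsmul_eq_mul]
    ext
    · change (levelHom M γ).x = _
      rw [levelHom_x_eq_zero hs]
    · rw [hyM, Heis.mul_y, add_zero]
    · rw [hzM, Heis.mul_z, zero_mul, add_zero, zero_add]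
  rw [key, map_pow, map_pow]
  exact Subgroup.subset_closure ⟨_, ⟨_, hδY, rfl⟩, rfl⟩

/-- **`N·(Δ^tp_Y)^Θ` in level coordinates (stage 2)**: for `γ ∈ Ker pr₂`, `θ(inl γ) ∈ N·(Δ^tp_Y)^Θ ↔ ĥ_N(γ) = 1`.
[cite: MochizukiEtTh2009, §1 p.14] -/
theorem toThetaq_inl_mem_thetaPowersY_iff {γ : Gfp} (hγ : γ ∈ gfpSnd.ker) :
    CurveTheta.toTheta (curveχq p i j) (SemidirectProduct.inl γ) ∈ (ThetaSetting.modelχq p i j hj).thetaPowersY N ↔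
      levelHom N γ = 1 := by
  constructor
  · intro h
    obtain ⟨γ', hγ', hEq⟩ := thetaPowersY_modelχq_le p i j hj N h
    rw [← levelHom_eq_of_toThetaq_inl_eq p i j hEq N]
    exact (Subgroup.mem_inf.mp hγ').2
  · intro h
    exact toThetaq_inl_mem_thetaPowersY_of_mem_dZ p i j hj N (Subgroup.mem_inf.mpr ⟨hγ, h⟩)

/-! ### The standard splitting and the `Z_N`-clause for it (stage 2) -/

/-- The standard lifted splitting `σ ↦ θ(inr σ)` over `G_{K_N}` of the stage-2 model is a lifted splitting.
[cite: MochizukiEtTh2009, §1 p.14] -/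
theorem isThetaSplittingAt_inr_modelχq :
    (ThetaSetting.modelχq p i j hj).IsThetaSplittingAt N
      (fun σ => (ThetaSetting.modelχq p i j hj).toTheta (SemidirectProduct.inr (σ : GQp p))) where
  exists_lift σ := ⟨SemidirectProduct.inr (σ : GQp p), inr_mem_YNχq p i j N σ.2, rfl, rfl⟩
  map_mul_mem σ τ := by
    show (ThetaSetting.modelχq p i j hj).toTheta
        (SemidirectProduct.inr ((σ * τ : ↥((ThetaSetting.modelχq p i j hj).GKN N)) : GQp p)) *
        ((ThetaSetting.modelχq p i j hj).toTheta (SemidirectProduct.inr (σ : GQp p)) *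
          (ThetaSetting.modelχq p i j hj).toTheta (SemidirectProduct.inr (τ : GQp p)))⁻¹ ∈ _
    rw [Subgroup.coe_mul, map_mul, map_mul, mul_inv_cancel]
    exact Subgroup.one_mem _

/-- `g · (inr g.right)⁻¹ = inl g.left` in `Γ ⋊_{actχq} G`. [cite: MochizukiEtTh2009, §1 p.12] -/
theorem mul_inv_inr_right_eq_inl_χq (g : PiTpχq p i j) :
    g * (SemidirectProduct.inr g.right)⁻¹ = SemidirectProduct.inl g.left := by
  rw [← map_inv]
  refine SemidirectProduct.ext ?_ ?_
  · rw [SemidirectProduct.mul_left, SemidirectProduct.left_inr, map_one, mul_one, SemidirectProduct.left_inl]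
  · rw [SemidirectProduct.mul_right, SemidirectProduct.right_inr, mul_inv_cancel, SemidirectProduct.right_inl]

/-- **The clause of `GtpZNFromSplitting` HOLDS at the stage-2 model for the standard splitting.**
[cite: MochizukiEtTh2009, §1 p.14] -/
theorem gtpZN_iff_of_inr_splitting_modelχq (g : PiTpχq p i j) :
    g ∈ (ThetaSetting.modelχq p i j hj).GtpZN N ↔
      g ∈ (ThetaSetting.modelχq p i j hj).GtpYN N ∧ ∃ h : (ThetaSetting.modelχq p i j hj).aug g ∈ (ThetaSetting.modelχq p i j hj).GJN N,
        (ThetaSetting.modelχq p i j hj).toTheta g *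
          ((fun σ : ↥((ThetaSetting.modelχq p i j hj).GKN N) =>
              (ThetaSetting.modelχq p i j hj).toTheta (SemidirectProduct.inr (σ : GQp p)))
            ⟨(ThetaSetting.modelχq p i j hj).aug g, (ThetaSetting.modelχq p i j hj).GJN_le_GKN N h⟩)⁻¹ ∈
          (ThetaSetting.modelχq p i j hj).thetaPowersY N := by
  constructor
  · intro hZ
    obtain ⟨hl, hr⟩ := (GfpTwistData₀.mem_ZN (tateTwistData₀ p i j)).mp hZ
    refine ⟨(GfpTwistData₀.mem_YN (tateTwistData₀ p i j)).mpr
        ⟨dZ_le_dY N hl, (ThetaSetting.modelχq p i j hj).GJN_le_GKN N hr⟩, hr, ?_⟩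
    show CurveTheta.toTheta (curveχq p i j) g * (CurveTheta.toTheta (curveχq p i j) (SemidirectProduct.inr g.right))⁻¹ ∈ _
    rw [← map_inv, ← map_mul, mul_inv_inr_right_eq_inl_χq]
    exact toThetaq_inl_mem_thetaPowersY_of_mem_dZ p i j hj N hl
  · rintro ⟨hY, hr, hmem⟩
    obtain ⟨hl, -⟩ := (GfpTwistData₀.mem_YN (tateTwistData₀ p i j)).mp hY
    have hs : g.left ∈ gfpSnd.ker := (Subgroup.mem_inf.mp hl).1
    change CurveTheta.toTheta (curveχq p i j) g *
        (CurveTheta.toTheta (curveχq p i j) (SemidirectProduct.inr g.right))⁻¹ ∈ _ at hmem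
    rw [← map_inv, ← map_mul, mul_inv_inr_right_eq_inl_χq] at hmem
    exact (GfpTwistData₀.mem_ZN (tateTwistData₀ p i j)).mpr
      ⟨Subgroup.mem_inf.mpr ⟨hs, (toThetaq_inl_mem_thetaPowersY_iff p i j hj N hs).mp hmem⟩, hr⟩

/-- **∃-form (stage 2)**: there IS a lifted splitting over `G_{K_N}` for which the printed characterisation of `Π^tp_{Z_N}`
holds at the stage-2 model. [cite: MochizukiEtTh2009, §1 p.14] -/
theorem exists_thetaSplitting_gtpZN_iff_modelχq :
    ∃ s : ↥((ThetaSetting.modelχq p i j hj).GKN N) → (ThetaSetting.modelχq p i j hj).GtpTheta,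
      (ThetaSetting.modelχq p i j hj).IsThetaSplittingAt N s ∧
        ∀ g : PiTpχq p i j, g ∈ (ThetaSetting.modelχq p i j hj).GtpZN N ↔
          g ∈ (ThetaSetting.modelχq p i j hj).GtpYN N ∧ ∃ h : (ThetaSetting.modelχq p i j hj).aug g ∈ (ThetaSetting.modelχq p i j hj).GJN N,
            (ThetaSetting.modelχq p i j hj).toTheta g *
                (s ⟨(ThetaSetting.modelχq p i j hj).aug g, (ThetaSetting.modelχq p i j hj).GJN_le_GKN N h⟩)⁻¹ ∈
              (ThetaSetting.modelχq p i j hj).thetaPowersY N :=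
  ⟨_, isThetaSplittingAt_inr_modelχq p i j hj N, gtpZN_iff_of_inr_splitting_modelχq p i j hj N⟩

end Literature.AnabelianGeometry.EtaleTheta.SettingModel

end
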